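import Literature.MathematicalPhysics.QuantumFieldTheory.Balaban1983to89.B9Thm311PosDefAveragingSwap

/-!
# `Balaban1983to89.B9Eq315QLetterL2SizeFromClosenessY` — T. Bałaban, *Propagators for lattice gauge theories in a background field*, Commun. Math. Phys. **99** (1985)
# 389–434 [Balaban1985BackgroundPropagators], (3.15) p. 393 (the sizes of the averaging operators) in the scale-weighted ℓ² norms of p. 393 («scalar products»), for
# ANY averaging letter ℓ²-CLOSE to the straight-contour `Q(U)` of (3.12): THE ℓ²-SIZE BINDER OF ROW 17 (Thm 3.11 p. 416 at a re-pinned letter) IS NOT AN INDEPENDENT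
# INPUT — it follows from the size of `Q(U)` and the closeness by the triangle inequality (pub-ymgap N06 [B9], director-ym №375 obligation (5) «(L7) sizes := n06-c»,
# the ℓ² currency)

statement-level skeleton of published theorems with citation tags; proofs where landed; nothing here is a claim about the Yang–Mills mass gap

THE PRINT.  (3.15) p. 393 (sizes of `Q(U)`, `Q*(U)`); p. 393 «scalar products» (the scale-weighted trace pairings); (3.26) p. 395 (`Δ_a = Δ + D_URD*_U + Q*aQ`);
Thm 3.11 p. 416 («`Δ_a` … is positive definite»).

WHY THIS FILE (pub-ymgap node N06 [B9], O5 ∕ R2 re-pin of the record's averaging letter to dag-n06-l's knit letter `QknitY`, director-ym №375).  dag-n06-j's row-17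
supplier `B9Thm311PosDefAveragingSwap.posDefTr_deltaAQY_of_formGap` (✓) transfers the form gap of `Δ_a^Q(U)` to `Δ_a^𝔮(U)` for any adjoint averaging pair
`(𝔮, 𝔮*)` from THREE ℓ² binders — the size `‖𝔮(U)A‖_w ≤ K‖A‖_wgt` (DISPLAYED, «hKnitSize», this seat's by his I.18707), the size `‖Q(U)A‖_w ≤ K′‖A‖_wgt`
(✓ his `B9Eq315QYSizeWeightedL2Y`, `K′ = √(2b₁)`) and the closeness `‖(𝔮(U) − Q(U))A‖_w ≤ δ‖A‖_wgt` (DISPLAYED, dag-n06-l's) — with `δ(K+K′) < γ`.  The first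
binder is REDUNDANT: the weighted trace pairing is a real inner product (`B9Thm311ReadingCoords.realify311`), so `‖𝔮(U)A‖_w ≤ ‖Q(U)A‖_w + ‖(𝔮(U)−Q(U))A‖_w ≤
(K′+δ)‖A‖_wgt`.  THIS FILE:
* §1 ★ `self_le_sq_of_close` — abstract: `‖Y‖²_w ≤ k_Y²n`, `‖X − Y‖²_w ≤ δ²n` ⟹ `‖X‖²_w ≤ (k_Y+δ)²n` (`w > 0`, `n, k_Y, δ ≥ 0`);
* §2 ★★ `trIP_w_le_of_close` — for any letter `Q′ : (fine bonds → M_N) →ₗ (index bonds → M_N)`: the ℓ²-size binder of `Q′` with constant `K′ + δ` from the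
  size binder of `Q_{parB}(U)` (`K′`) and the closeness binder (`δ`), in the output weight `i.w` and any input weight `wgt > 0` — i.e. row 17's `hsize` DERIVED;
* §3 ★★ `posDefTr_deltaA_swap_of_formGap_of_close`, ★★★ `posDefTr_deltaAQY_of_formGap_of_close` — dag-n06-j's positivity transfers WITHOUT the `hsize`
  binder: form gap `γ` of `Δ_a^{parB}(U)`, size `K′` of `Q_{parB}(U)`, closeness `δ`, and the numeric `δ(2K′+δ) < γ` ⟹ `PosDefTr 1 (Δ_a^𝔮(U))` (at def-Y's v10
  letter `Node00.deltaAQY` by name) — so the v10 certificate's row 17 at `𝔮 := qKnitOfRecord` displays ONE knit binder (the closeness) instead of two.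

HONEST SCOPE ∕ NOT CLAIMED.  Finite-dimensional inner-product algebra (triangle inequality in the chart `realify311`) composed with LANDED theorems by name; no
estimate of [B9] is proved here; the closeness binder `δ` (dag-n06-l lineage, from [B8]'s junction estimates) and the form gap REMAIN hypotheses exactly as in
`B9Thm311PosDefAveragingSwap`; count-neutral; row 17 ∕ N06 NOT discharged; nothing continuum ∕ OS ∕ mass gap ∕ Clay.  NEW file; 0 `def`, no `sorry`, no `axiom`,
no `instance`, no `notation`.  Cell `pub-ymgap` (D-0062), seat `pub-ymgap-dag-n06-c` (gen 23), 2026-08-30; `--supports stmt-QuantumFields-27364`.  Net new unproved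
facts: 0.

RELATED IN THE TREE, NOT DUPLICATED (searched 2026-08-30: `rg` for the basename and the four decl names over `lean/Literature` + `lean/Summits` — 0 hits):
dag-n06-j `B9Thm311PosDefAveragingSwap` (`abs_self_sub_self_le_of_sq_le` — the polarisation bound in the same chart, the model of §1; `posDefTr_deltaA_swap_of_formGap`,
`posDefTr_deltaAQY_of_formGap` — USED), `B9Eq315QYSizeWeightedL2Y` (the `K′` supplier), this seat's `B9Eq315QknitSizesY` ∕ `…RecordY` ((3.15) for the knit letter
in the SUP norm — a different currency, not used here), `B9Thm311ReadingCoords` (`realify311`, `norm_sq_realify311`; USED).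
-/

noncomputable section

open scoped BigOperators

namespace Literature.MathematicalPhysics.QuantumFieldTheory.Balaban1983to89.B9Eq315QLetterL2SizeFromClosenessY

open B9Thm311ReadingCoords Node00 B9Thm311PosDefAveragingSwap
open B6KLevelCensusIndexV1 (KIdx)
open B9Thm311DeltaPrimePos (trIP_self_nonneg)
open scoped Matrix.Norms.L2Operator

/-! ## §1 Abstract: the triangle inequality for the weighted trace norm, squared -/

section Abstract

variable {S' : Type} [Fintype S'] {N : ℕ}

/-- ★ **`‖X‖²_w ≤ (k_Y + δ)²·n`** whenever `‖Y‖²_w ≤ k_Y²·n` and `‖X − Y‖²_w ≤ δ²·n` (`w > 0`; `n, k_Y, δ ≥ 0`): the weighted trace pairing is a real inner product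
in the orthonormal chart `realify311`, and `‖x‖ ≤ ‖y‖ + ‖x − y‖`. [cite: Balaban1985BackgroundPropagators, p.393 (scalar products), bookkeeping] -/
theorem self_le_sq_of_close {w : S' → ℝ} (hw : ∀ s, 0 < w s) (X Y : S' → Matrix (Fin N) (Fin N) ℂ) {n kY δ : ℝ}
    (hn : 0 ≤ n) (hkY : 0 ≤ kY) (hδ : 0 ≤ δ)
    (hY : trIP w Y Y ≤ kY ^ 2 * n) (hXY : trIP w (X - Y) (X - Y) ≤ δ ^ 2 * n) :
    trIP w X X ≤ (kY + δ) ^ 2 * n := by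
  have eX : trIP w X X = ‖realify311 w hw X‖ ^ 2 := (norm_sq_realify311 (hw := hw) X).symm
  have eY : trIP w Y Y = ‖realify311 w hw Y‖ ^ 2 := (norm_sq_realify311 (hw := hw) Y).symm
  have eXY : trIP w (X - Y) (X - Y) = ‖realify311 w hw X - realify311 w hw Y‖ ^ 2 := by
    rw [← map_sub, norm_sq_realify311 (hw := hw)]
  have bound : ∀ {v : EuclideanSpace ℝ (Idx311 S' (Fin N))} {k : ℝ}, 0 ≤ k → ‖v‖ ^ 2 ≤ k ^ 2 * n → ‖v‖ ≤ k * Real.sqrt n := by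
    intro v k hk h
    have h1 : ‖v‖ ≤ Real.sqrt (k ^ 2 * n) := (Real.le_sqrt (norm_nonneg _) (by positivity)).2 h
    rwa [Real.sqrt_mul (sq_nonneg k), Real.sqrt_sq hk] at h1
  have bY := bound hkY (eY ▸ hY)
  have bXY := bound hδ (eXY ▸ hXY)
  -- `‖x‖ ≤ ‖y‖ + ‖x − y‖ ≤ (k_Y + δ)·√n`
  have htri : ‖realify311 w hw X‖ ≤ (kY + δ) * Real.sqrt n := by
    have h := norm_le_norm_add_norm_sub' (realify311 w hw X) (realify311 w hw Y)
    -- `h : ‖x‖ ≤ ‖y‖ + ‖x - y‖`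
    calc ‖realify311 w hw X‖ ≤ ‖realify311 w hw Y‖ + ‖realify311 w hw X - realify311 w hw Y‖ := h
      _ ≤ kY * Real.sqrt n + δ * Real.sqrt n := add_le_add bY bXY
      _ = (kY + δ) * Real.sqrt n := by ring
  have h0 : 0 ≤ (kY + δ) * Real.sqrt n := mul_nonneg (add_nonneg hkY hδ) (Real.sqrt_nonneg n)
  rw [eX]
  calc ‖realify311 w hw X‖ ^ 2 ≤ ((kY + δ) * Real.sqrt n) ^ 2 := pow_le_pow_left₀ (norm_nonneg _) htri 2
    _ = (kY + δ) ^ 2 * (Real.sqrt n ^ 2) := by ring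
    _ = (kY + δ) ^ 2 * n := by rw [Real.sq_sqrt hn]

end Abstract

/-! ## §2 Row 17's ℓ²-size binder of a re-pinned averaging letter, DERIVED from the size of `Q_{parB}(U)` and the closeness -/

section Letters

variable {d ℓ : ℕ} {hd : 1 ≤ d + 1} {hL : Odd (ℓ + 1) ∧ 1 < ℓ + 1} {b₀ b₁ : ℝ} {N : ℕ}
variable (i : KIdx d ℓ hd hL b₀ b₁) {G : Subgroup (Matrix (Fin N) (Fin N) ℂ)ˣ}

/-- ★★ **THE ℓ²-SIZE OF A LETTER CLOSE TO `Q_{parB}(U)`** ((3.15) in the scale-weighted norms, transported): if `‖Q_{parB}(U)A‖²_w ≤ K′²⟨A,A⟩_wgt` and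
`‖(Q′ − Q_{parB}(U))A‖²_w ≤ δ²⟨A,A⟩_wgt` for all `A` (`wgt > 0`, `K′, δ ≥ 0`), then `‖Q′A‖²_w ≤ (K′+δ)²⟨A,A⟩_wgt` for all `A` — row 17's size binder `hsize`
for the re-pinned letter with `K := K′ + δ`. [cite: Balaban1985BackgroundPropagators, (3.15) p.393, p.393 (scalar products)] -/
theorem trIP_w_le_of_close (Q : (FBondY i → Matrix (Fin N) (Fin N) ℂ) →ₗ[ℂ] (IBondY i → Matrix (Fin N) (Fin N) ℂ))
    (parB : BondParY (Matrix (Fin N) (Fin N) ℂ) i) (U : CfgY (Matrix (Fin N) (Fin N) ℂ) i) {wgt : FBondY i → ℝ} (hwgt : ∀ b, 0 < wgt b)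
    {K' δ : ℝ} (hK' : 0 ≤ K') (hδ : 0 ≤ δ)
    (hsizeY : ∀ A, trIP i.w (QY i parB U A) (QY i parB U A) ≤ K' ^ 2 * trIP wgt A A)
    (hclose : ∀ A, trIP i.w ((Q - QY i parB U) A) ((Q - QY i parB U) A) ≤ δ ^ 2 * trIP wgt A A)
    (A : FBondY i → Matrix (Fin N) (Fin N) ℂ) :
    trIP i.w (Q A) (Q A) ≤ (K' + δ) ^ 2 * trIP wgt A A := by
  have hXY : trIP i.w (Q A - QY i parB U A) (Q A - QY i parB U A) ≤ δ ^ 2 * trIP wgt A A := by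
    have h := hclose A
    rwa [LinearMap.sub_apply] at h
  exact self_le_sq_of_close i.hw (Q A) (QY i parB U A) (trIP_self_nonneg wgt hwgt A) hK' hδ (hsizeY A) hXY

/-! ## §3 The positivity transfers of `B9Thm311PosDefAveragingSwap` without the size binder of the re-pinned letter -/

/-- ★★ **POSITIVITY TRANSFER, TWO ℓ² BINDERS**: a form gap `γ·⟨A,A⟩_wgt ≤ ⟨A, Δ_a^{parB}(U)A⟩₁`, the size `K′` of `Q_{parB}(U)`, the closeness `δ` of the adjoint
pair `(Q, Qs)` to it, and `δ(2K′+δ) < γ` give `PosDefTr 1 (Δ(U) + D_UR(U)D*_U + Qs∘a∘Q)` (dag-n06-j's `posDefTr_deltaA_swap_of_formGap` with `K := K′ + δ` from §2).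
[cite: Balaban1985BackgroundPropagators, Thm 3.11 p.416, (3.26) p.395, (3.15) p.393] -/
theorem posDefTr_deltaA_swap_of_formGap_of_close (hG : G ≤ B7Prop2Explicit.unitaryUnits (Matrix (Fin N) (Fin N) ℂ))
    (parS : SiteParY (Matrix (Fin N) (Fin N) ℂ) i) {parB : BondParY (Matrix (Fin N) (Fin N) ℂ) i} (Gp : SiteOpY (Matrix (Fin N) (Fin N) ℂ) i)
    {U : CfgY (Matrix (Fin N) (Fin N) ℂ) i} (hpar : ∀ s s', parB U s s' ∈ G)
    {Q : (FBondY i → Matrix (Fin N) (Fin N) ℂ) →ₗ[ℂ] (IBondY i → Matrix (Fin N) (Fin N) ℂ)}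
    {Qs : (IBondY i → Matrix (Fin N) (Fin N) ℂ) →ₗ[ℂ] (FBondY i → Matrix (Fin N) (Fin N) ℂ)}
    (hQ : IsAdjTr (fun _ => (1 : ℝ)) (fun _ => (1 : ℝ)) Q Qs) {wgt : FBondY i → ℝ} (hwgt : ∀ b, 0 < wgt b)
    {γ K' δ : ℝ} (hK' : 0 ≤ K') (hδ : 0 ≤ δ)
    (hgap : ∀ A, γ * trIP wgt A A ≤ trIP (fun _ => (1 : ℝ)) A (deltaAY i parS parB Gp U A))
    (hsizeY : ∀ A, trIP i.w (QY i parB U A) (QY i parB U A) ≤ K' ^ 2 * trIP wgt A A)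
    (hclose : ∀ A, trIP i.w ((Q - QY i parB U) A) ((Q - QY i parB U) A) ≤ δ ^ 2 * trIP wgt A A) (hβ : δ * (2 * K' + δ) < γ) :
    PosDefTr (fun _ => (1 : ℝ)) (hessY i U + gradY i U ∘ₗ RY i parS Gp U ∘ₗ divY i U + Qs ∘ₗ aY i ∘ₗ Q) :=
  posDefTr_deltaA_swap_of_formGap i hG parS Gp hpar hQ hwgt (add_nonneg hK' hδ) hK' hδ hgap
    (trIP_w_le_of_close i Q parB U hwgt hK' hδ hsizeY hclose) hsizeY hclose (by linarith)

/-- ★★★ **ROW 17 AT def-Y's v10 LETTER `Node00.deltaAQY`, TWO ℓ² BINDERS**: for an adjoint averaging family `(𝔮, 𝔮s)` at `U`, a form gap `γ` of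
`Δ_a^{parB}(U)` in a weight `wgt > 0`, the size `K′` of `Q_{parB}(U)`, the closeness `‖(𝔮(U) − Q_{parB}(U))A‖_w ≤ δ‖A‖_wgt` and `δ(2K′+δ) < γ`:
`PosDefTr 1 (deltaAQY i 𝔮 𝔮s parS Gp U)` — dag-n06-j's `posDefTr_deltaAQY_of_formGap` with its `hsize` binder discharged by §2 (`K := K′ + δ`); at
`𝔮 := qKnitOfRecord` the certificate displays the knit pair's CLOSENESS only. [cite: Balaban1985BackgroundPropagators, Thm 3.11 p.416, (3.26) p.395, (3.15) p.393] -/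
theorem posDefTr_deltaAQY_of_formGap_of_close (hG : G ≤ B7Prop2Explicit.unitaryUnits (Matrix (Fin N) (Fin N) ℂ))
    (parS : SiteParY (Matrix (Fin N) (Fin N) ℂ) i) {parB : BondParY (Matrix (Fin N) (Fin N) ℂ) i} (Gp : SiteOpY (Matrix (Fin N) (Fin N) ℂ) i)
    {U : CfgY (Matrix (Fin N) (Fin N) ℂ) i} (hpar : ∀ s s', parB U s s' ∈ G)
    {𝔮 : CfgY (Matrix (Fin N) (Fin N) ℂ) i → ((FBondY i → Matrix (Fin N) (Fin N) ℂ) →ₗ[ℂ] (IBondY i → Matrix (Fin N) (Fin N) ℂ))}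
    {𝔮s : CfgY (Matrix (Fin N) (Fin N) ℂ) i → ((IBondY i → Matrix (Fin N) (Fin N) ℂ) →ₗ[ℂ] (FBondY i → Matrix (Fin N) (Fin N) ℂ))}
    (hQ : IsAdjTr (fun _ => (1 : ℝ)) (fun _ => (1 : ℝ)) (𝔮 U) (𝔮s U)) {wgt : FBondY i → ℝ} (hwgt : ∀ b, 0 < wgt b)
    {γ K' δ : ℝ} (hK' : 0 ≤ K') (hδ : 0 ≤ δ)
    (hgap : ∀ A, γ * trIP wgt A A ≤ trIP (fun _ => (1 : ℝ)) A (deltaAY i parS parB Gp U A))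
    (hsizeY : ∀ A, trIP i.w (QY i parB U A) (QY i parB U A) ≤ K' ^ 2 * trIP wgt A A)
    (hclose : ∀ A, trIP i.w ((𝔮 U - QY i parB U) A) ((𝔮 U - QY i parB U) A) ≤ δ ^ 2 * trIP wgt A A) (hβ : δ * (2 * K' + δ) < γ) :
    PosDefTr (fun _ => (1 : ℝ)) (deltaAQY i 𝔮 𝔮s parS Gp U) :=
  posDefTr_deltaAQY_of_formGap i hG parS Gp hpar hQ hwgt (add_nonneg hK' hδ) hK' hδ hgap
    (trIP_w_le_of_close i (𝔮 U) parB U hwgt hK' hδ hsizeY hclose) hsizeY hclose (by linarith)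

end Letters

end Literature.MathematicalPhysics.QuantumFieldTheory.Balaban1983to89.B9Eq315QLetterL2SizeFromClosenessY

end
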